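import Mathlib
import Summits.NavierStokesRegularity.NavierStokesRegularity.Theorems.SubOnsagerCeilingKPChainOccupation
import HarnessLib

/-!
# Higher-moment occupation identities for the viscous Katz–Pavlović chain: the `(2, c-1)` moment of a bond is the
# `(c, 1)` moment of the next bond (helper file for the crux `SubOnsagerCeiling.ForwardTailCeilingKP`,
# stmt-NavierStokesRegularity-27057, `--supports`; hand leafhand-ns-subonsagerceiling-4 gen 24; def-free; the `c ≥ 1`
# generalisation of `Theorems.KPChainOccupation.occupation_identity`, which is `c = 1`)

Chain format VERBATIM that of `Theorems/SubOnsagerCeilingKPChainOccupation.lean` (`Ż_k = c₀ (b^{5(k-1)/2} Z_{k-1}² − b^{5k/2} Z_k Z_{k+1})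
− ν b^{2k} Z_k` from the one-shell datum `Z_k(0) = x₀ 1_{k=0}`, continuous on `[0,s]`).  Integrating `d/dt Z_{k+1}^c / c` over `[0,T]`:

* **`moment_identity`** — for every `c ≥ 1`, `k ≥ 0`, `T ∈ [0,s]` (any signs, any `ν`):
  `Z_{k+1}(T)^c = c·[ c₀ b^{5k/2} ∫₀ᵀ Z_k² Z_{k+1}^{c-1} − c₀ b^{5(k+1)/2} ∫₀ᵀ Z_{k+1}^c Z_{k+2} − ν b^{2(k+1)} ∫₀ᵀ Z_{k+1}^c ]`;
* `nextBondMoment_le` — for the non-negative chain (`ν ≥ 0`, `b > 0`, shells `≥ 1` non-negative, any `c₀`):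
  `c₀ b^{5(k+1)/2} ∫₀ᵀ Z_{k+1}^c Z_{k+2} ≤ c₀ b^{5k/2} ∫₀ᵀ Z_k² Z_{k+1}^{c-1}` — the `(c,1)` moment of the bond `k+1 → k+2` is fed only by
  the `(2,c-1)` moment of the bond `k → k+1`, uniformly in `ν`.

Use (memo ENTROPY-PRODUCTION-leafhand4-g24 v2 on the item, §D.7).  With `c = 2p` this is the dictionary between the per-bond NET
entropy production of the Kolmogorov entropy `S_p` (`Theorems/SubOnsagerCeilingKPChainEntropyProduction.lean`: production density
`Π_n (w_{n+1}^{p-1} − w_n^{p-1})`, i.e. the bond moments `∫ Z_n² Z_{n+1}^{2p-1}` versus `∫ Z_n^{2p} Z_{n+1}`) and the DECAY OF THE `(2p,1)`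
BOND MOMENTS ALONG THE CHAIN: the conjectured per-bond entropy inequality PB-ENT_p (every bond net-destructive, measured for `p = 2.6`
at every tested ratio) reads `∫ Z_{n+1}^{2p} Z_{n+2} ≤ b^{-(5/6)(2p+1)} ∫ Z_n^{2p} Z_{n+1}` — geometric decay at EXACTLY the Kolmogorov rate,
the `p`-moment form of the K41-criticality of the occupation recursion recorded by hand 4-g12.  Nothing here closes a stub.
HONEST FRAMING: statements about a MODEL lattice ODE (route SubOnsagerCeiling, rung TL-M2Break); nothing here bears on
Navier–Stokes regularity and no crux or summit is proved. [cite: Tao2016AveragedNS, §4 (4.13)] [cite: BarbatoMorandinRomito2011, §2 (the chain)]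
-/

noncomputable section

-- the sub-problem namespace `NavierStokesRegularity.NavierStokesRegularity` is the tree's layout (D-0017)
set_option linter.dupNamespace false

namespace Summit.NavierStokesRegularity.NavierStokesRegularity.Theorems.KPChainEntropy

open Set MeasureTheory intervalIntegral
open Summit.NavierStokesRegularity.NavierStokesRegularity.Theorems.KPChainOccupation

/-- **Higher-moment occupation identity.**  Along an honest solution of the viscous chain from the one-shell datum (any signs,
any `ν`, `c₀`, `b`), for every exponent `c ≥ 1`, shell `k ≥ 0` and `T ∈ [0,s]`:
`Z_{k+1}(T)^c = c·(c₀ b^{5k/2} ∫₀ᵀ Z_k² Z_{k+1}^{c-1} − c₀ b^{5(k+1)/2} ∫₀ᵀ Z_{k+1}^c Z_{k+2} − ν b^{2(k+1)} ∫₀ᵀ Z_{k+1}^c)`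
(the shell `k+1` starts empty). [this file] -/
theorem moment_identity {b c₀ ν s x₀ : ℝ} {Z : ℤ → ℝ → ℝ}
    (hdat : ∀ k : ℤ, Z k 0 = if k = 0 then x₀ else 0)
    (hcont : ∀ k : ℕ, ContinuousOn (Z k) (Icc 0 s))
    (hode : ∀ k : ℕ, ∀ t ∈ Icc 0 s, HasDerivWithinAt (Z k)
      (c₀ * (b ^ ((5 : ℝ) * ((k : ℝ) - 1) / 2) * Z ((k : ℤ) - 1) t ^ 2 -
          b ^ ((5 : ℝ) * (k : ℝ) / 2) * (Z k t * Z ((k : ℤ) + 1) t)) -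
        ν * b ^ ((2 : ℝ) * (k : ℝ)) * Z k t) (Icc 0 s) t)
    {c : ℕ} (hc : 1 ≤ c) (k : ℕ) {T : ℝ} (hT : T ∈ Icc 0 s) :
    Z ((k : ℤ) + 1) T ^ c =
      (c : ℝ) * (c₀ * b ^ ((5 : ℝ) * (k : ℝ) / 2) * (∫ t in (0 : ℝ)..T, Z (k : ℤ) t ^ 2 * Z ((k : ℤ) + 1) t ^ (c - 1)) -
        c₀ * b ^ ((5 : ℝ) * ((k : ℝ) + 1) / 2) * (∫ t in (0 : ℝ)..T, Z ((k : ℤ) + 1) t ^ c * Z ((k : ℤ) + 2) t) -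
        ν * b ^ ((2 : ℝ) * ((k : ℝ) + 1)) * (∫ t in (0 : ℝ)..T, Z ((k : ℤ) + 1) t ^ c)) := by
  obtain ⟨q, rfl⟩ : ∃ q, c = q + 1 := ⟨c - 1, by omega⟩
  simp only [Nat.add_sub_cancel]
  obtain ⟨hc0, hc1, hc2⟩ := continuousOn_shells hcont hT.2 k
  set B₀ : ℝ := b ^ ((5 : ℝ) * (k : ℝ) / 2) with hB₀
  set B₁ : ℝ := b ^ ((5 : ℝ) * ((k : ℝ) + 1) / 2) with hB₁
  set B₂ : ℝ := b ^ ((2 : ℝ) * ((k : ℝ) + 1)) with hB₂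
  -- the three integrands are continuous on `[0,T]`, hence interval integrable
  have hF1c : ContinuousOn (fun t => c₀ * B₀ * (Z (k : ℤ) t ^ 2 * Z ((k : ℤ) + 1) t ^ q)) (Icc 0 T) :=
    continuousOn_const.mul ((hc0.pow 2).mul (hc1.pow q))
  have hF2c : ContinuousOn (fun t => c₀ * B₁ * (Z ((k : ℤ) + 1) t ^ (q + 1) * Z ((k : ℤ) + 2) t)) (Icc 0 T) :=
    continuousOn_const.mul ((hc1.pow (q + 1)).mul hc2)
  have hF3c : ContinuousOn (fun t => ν * B₂ * Z ((k : ℤ) + 1) t ^ (q + 1)) (Icc 0 T) :=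
    continuousOn_const.mul (hc1.pow (q + 1))
  have hF1i : IntervalIntegrable (fun t => c₀ * B₀ * (Z (k : ℤ) t ^ 2 * Z ((k : ℤ) + 1) t ^ q)) volume 0 T :=
    hF1c.intervalIntegrable_of_Icc hT.1
  have hF2i : IntervalIntegrable (fun t => c₀ * B₁ * (Z ((k : ℤ) + 1) t ^ (q + 1) * Z ((k : ℤ) + 2) t)) volume 0 T :=
    hF2c.intervalIntegrable_of_Icc hT.1
  have hF3i : IntervalIntegrable (fun t => ν * B₂ * Z ((k : ℤ) + 1) t ^ (q + 1)) volume 0 T :=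
    hF3c.intervalIntegrable_of_Icc hT.1
  -- fundamental theorem of calculus for `Z_{k+1}^{q+1}/(q+1)` on `[0,T]`
  have hderiv : ∀ t ∈ Ioo 0 T, HasDerivWithinAt (fun τ => Z ((k : ℤ) + 1) τ ^ (q + 1))
      (((q + 1 : ℕ) : ℝ) * (c₀ * B₀ * (Z (k : ℤ) t ^ 2 * Z ((k : ℤ) + 1) t ^ q) -
        c₀ * B₁ * (Z ((k : ℤ) + 1) t ^ (q + 1) * Z ((k : ℤ) + 2) t) -
        ν * B₂ * Z ((k : ℤ) + 1) t ^ (q + 1))) (Ioi t) t := by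
    intro t ht
    have hts : t ∈ Icc 0 s := ⟨ht.1.le, ht.2.le.trans hT.2⟩
    have h := hasDerivWithinAt_succ hode k t hts
    have hnhds : Icc (0 : ℝ) s ∈ nhds t := Icc_mem_nhds ht.1 (lt_of_lt_of_le ht.2 hT.2)
    have h' := ((h.hasDerivAt hnhds).hasDerivWithinAt (s := Ioi t)).pow (q + 1)
    refine h'.congr_deriv ?_
    simp only [Nat.add_sub_cancel]
    rw [hB₀, hB₁, hB₂]
    ring
  have hint : IntervalIntegrable (fun t => ((q + 1 : ℕ) : ℝ) * (c₀ * B₀ * (Z (k : ℤ) t ^ 2 * Z ((k : ℤ) + 1) t ^ q) -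
      c₀ * B₁ * (Z ((k : ℤ) + 1) t ^ (q + 1) * Z ((k : ℤ) + 2) t) -
      ν * B₂ * Z ((k : ℤ) + 1) t ^ (q + 1))) volume 0 T :=
    ((hF1i.sub hF2i).sub hF3i).const_mul _
  have hcontpow : ContinuousOn (fun τ => Z ((k : ℤ) + 1) τ ^ (q + 1)) (Icc 0 T) := hc1.pow (q + 1)
  have hFTC := integral_eq_sub_of_hasDeriv_right_of_le hT.1 hcontpow hderiv hint
  have hz0 : Z ((k : ℤ) + 1) 0 = 0 := by
    rw [hdat]
    have hne : (k : ℤ) + 1 ≠ 0 := by omega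
    rw [if_neg hne]
  have hq0 : (0 : ℝ) ^ (q + 1) = 0 := by simp
  simp only [hz0, hq0, sub_zero] at hFTC
  rw [intervalIntegral.integral_const_mul, intervalIntegral.integral_sub (hF1i.sub hF2i) hF3i,
    intervalIntegral.integral_sub hF1i hF2i, intervalIntegral.integral_const_mul,
    intervalIntegral.integral_const_mul, intervalIntegral.integral_const_mul] at hFTC
  rw [hFTC]

/-- **The `(c,1)` moment of the next bond is fed by the `(2,c-1)` moment of the present one** (shells `≥ 1` non-negative,
`ν ≥ 0`, `b > 0`, any coupling `c₀`): `c₀ b^{5(k+1)/2} ∫₀ᵀ Z_{k+1}^c Z_{k+2} ≤ c₀ b^{5k/2} ∫₀ᵀ Z_k² Z_{k+1}^{c-1}` for every `c ≥ 1`, `k ≥ 0`,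
`T ∈ [0,s]` — uniformly in `ν`.  For `c = 2p` this is the statement that the per-bond net entropy production of `S_p` controls
the decay of the `(2p,1)` bond moments along the chain (memo §D.7). [this file] -/
theorem nextBondMoment_le {b c₀ ν s x₀ : ℝ} (hb : 0 < b) (hν : 0 ≤ ν) {Z : ℤ → ℝ → ℝ}
    (hdat : ∀ k : ℤ, Z k 0 = if k = 0 then x₀ else 0)
    (hcont : ∀ k : ℕ, ContinuousOn (Z k) (Icc 0 s))
    (hode : ∀ k : ℕ, ∀ t ∈ Icc 0 s, HasDerivWithinAt (Z k)
      (c₀ * (b ^ ((5 : ℝ) * ((k : ℝ) - 1) / 2) * Z ((k : ℤ) - 1) t ^ 2 -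
          b ^ ((5 : ℝ) * (k : ℝ) / 2) * (Z k t * Z ((k : ℤ) + 1) t)) -
        ν * b ^ ((2 : ℝ) * (k : ℝ)) * Z k t) (Icc 0 s) t)
    (hnn : ∀ t ∈ Icc 0 s, ∀ k : ℕ, 1 ≤ k → 0 ≤ Z k t)
    {c : ℕ} (hc : 1 ≤ c) (k : ℕ) {T : ℝ} (hT : T ∈ Icc 0 s) :
    c₀ * b ^ ((5 : ℝ) * ((k : ℝ) + 1) / 2) * (∫ t in (0 : ℝ)..T, Z ((k : ℤ) + 1) t ^ c * Z ((k : ℤ) + 2) t) ≤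
      c₀ * b ^ ((5 : ℝ) * (k : ℝ) / 2) * (∫ t in (0 : ℝ)..T, Z (k : ℤ) t ^ 2 * Z ((k : ℤ) + 1) t ^ (c - 1)) := by
  have hid := moment_identity hdat hcont hode hc k hT
  have h1 : ∀ t ∈ Icc 0 s, 0 ≤ Z ((k : ℤ) + 1) t := fun t ht => by
    have := hnn t ht (k + 1) (by omega); push_cast at this; exact this
  have hZc : 0 ≤ Z ((k : ℤ) + 1) T ^ c := pow_nonneg (h1 T hT) c
  have hI3 : 0 ≤ ν * b ^ ((2 : ℝ) * ((k : ℝ) + 1)) * (∫ t in (0 : ℝ)..T, Z ((k : ℤ) + 1) t ^ c) := by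
    refine mul_nonneg (mul_nonneg hν (Real.rpow_pos_of_pos hb _).le)
      (intervalIntegral.integral_nonneg hT.1 fun t ht => ?_)
    exact pow_nonneg (h1 t ⟨ht.1, ht.2.trans hT.2⟩) c
  have hcpos : (0 : ℝ) < (c : ℝ) := by exact_mod_cast hc
  -- from the identity: c·(I1 − I2 − I3) = Z^c ≥ 0, hence I2 ≤ I1 − I3 ≤ I1
  rw [hid] at hZc
  have hkey := (mul_nonneg_iff_of_pos_left hcpos).1 hZc
  linarith

end Summit.NavierStokesRegularity.NavierStokesRegularity.Theorems.KPChainEntropy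

end
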